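import Summits.BirchSwinnertonDyer.Rank1Residual.WAll.TargetCMTwoRamifiedRhoSix
import Summits.BirchSwinnertonDyer.Rank1Residual.WAll.AltClosersCMTwoRamifiedFamilies
import Summits.BirchSwinnertonDyer.BirchSwinnertonDyer.Theorems.PrintCf2RamifiedOffTYZSMinusLeaf
import Summits.BirchSwinnertonDyer.BirchSwinnertonDyer.Theorems.PrintCf2RamifiedOffTYZAtlasFJLeaf
import HarnessLib

/-!
# Route `PrintCf2`, crux stmt-BirchSwinnertonDyer-20509 `RamifiedOffTYZOfFacts` — THE TYZ GENUS CLASS AT `ρ = 0`,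
# RESIDUE CLASS `6 (mod 8)`: THE EXACT FLAG-FREE REACH OF TYZ THM 1.2's `n ≡ 6` CLAUSE INSIDE THE BUNDLE (an
# empirically THIN class — see the caveat below; cell `bsd-print-cf2`, p1)

HONEST FRAMING (cell `bsd-print-cf2`; route `PrintCf2`; crux 20509 = `𝔅_ram → WAllCornerFTwoRamifiedOffTYZProved`,
OPEN): after the `𝒮⁻` carve-out (p544597 / p546023; skeleton 58c6ad09: `stub_offTYZ_uPlusLeaf` / `stub_offTYZ_sMinusLeaf`
LANDED / `stub_offTYZ_residual` five-way) this file takes a SECOND explicit class out of the residual and closes it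
WITHIN `𝔅_ram`, FLAG-FREE: the Tian–Yuan–Zhang genus class at `ρ(n) = 0` in residue class `n ≡ 6 (mod 8)` —
square-free `n ≡ 6 (8)`, `#Sel₂(E_n) = 8`, `[E_n(ℚ) : φ_n(A_n(ℚ)) + E_n[2]] = 1`, `Σ₂′(n)` odd (leaf
`WAllCornerFTwoRamifiedTYZRhoSix` of `WAll/TargetCMTwoRamifiedRhoSix.lean`, p547613). Such members (IF ANY — see the
EMPIRICAL CAVEAT below) sat under the U⁺ road only (`CongruentTYZUPlusFamily`, `n ≡ 6` clause; LITERAL, aside 20471).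
The mathematics is the `n ≡ 6`
clause of TYZ Thm 1.2 AS PRINTED (`thm12_parity_of_scriptL'`, conjunct 5 of `𝔅_ram`; tree
`TianYuanZhang2017.rankOneDatum_of_index_eq_one_six'`: `ord_{s=1} L(E_n, s) = 1` and
`L′(E_n,1) = 2^{2k(n)−2−a(n)} · L² · Ω · Reg` with `L` odd), Gross–Zagier–Kolyvagin (`hGZK`, conjunct 1: rank `1`),
`#Sel₂ = 8` ⇒ `Ш[2^∞] = 0`, and the PROVED bridge (`#E_n(ℚ)_tor = 4`, `ord₂ ∏c_ℓ = 2k + 2 − a`, `Ω = Ω_{n,∞}`) —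
line by line the proof of p1 g0's `rankOne_sha_bsdp_two_congruentNumberCurve_of_tyzGenus` (classes 5/7, p535702)
with the `_six'` datum. CONTENTS: §1 the per-`n` theorem `rankOne_sha_bsdp_two_congruentNumberCurve_of_tyzGenus_six`;
§2 the closer `wAllCornerFTwoRamifiedTYZRhoSix_of_facts (h12) (hGZK)` (fact-free model transport); §3 the NEW stub
`stub_offTYZ_rhoSixLeaf : 𝔅_ram → WAllCornerFTwoRamifiedTYZRhoSix` (PROVED), the reduction of the registered
residual stub (`𝔅_ram →` five-way residual `⇐ 𝔅_ram →` six-way residual) and the crux's conclusion from the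
reshaped stub set. No route file imported (bsd-wall T9). Nothing asserted; conditional exactly as the item is.
Beyond print: YES as an assembly of printed inputs (no printed theorem states BSD(E_n, 2) on this class; the step
`ρ(n) = 0` is a displayed hypothesis of the class, as for TYZρ).  EMPIRICAL CAVEAT (numbers, not adjectives): the
class is THIN — among the rank-one `E_n` with `n ≤ 2999`, `n ≡ 6 (mod 8)`, `s(n) = 1` and `Σ₂′(n)` odd, the index
`ρ(n)` is `1` in all 166 determined cases and `0` in NONE (p2-g2 census, kit job j282439, evidence on crux 20509;
41 undetermined), and `ρ(2n) = 1` on all 87 853 members `< 3·10⁶` of Tian's class 6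
(`Tian2014/ClassSixFamilyDescentProofs.lean`, module docstring).  So this file records the exact flag-free reach of
TYZ Thm 1.2's `n ≡ 6` clause inside `𝔅_ram` — it does NOT claim a populated family, and the even genus-odd members
with `ρ = 1` remain under the U⁺ road (LITERAL, aside 20471).  The registered skeleton of 20509 (58c6ad09) is NOT
re-cut along this class.
[cite: TianYuanZhang2017, Thm. 1.2 (n ≡ 6 clause) and §1 (1.1) (arXiv:1411.4728 p0002)]
[cite: Tian2023CongruentICM, Thm. 8 (p. 1996), Thm. 13 (p. 2000–2001)] [cite: SilvermanAEC2009, Thm. X.4.2]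
[cite: Miller2011LMS, Def. 1.1 (arXiv:1010.2431 p. 3)]
-/

noncomputable section

open scoped Classical

open WeierstrassCurve Summit.BirchSwinnertonDyer Summit.BirchSwinnertonDyer.Rank1Residual
  Literature.NumberTheory.EllipticCurves Literature.NumberTheory.EllipticCurves.Rank1Residual
  Literature.NumberTheory.EllipticCurves.TianYuanZhang2017

set_option autoImplicit false

namespace Summit.BirchSwinnertonDyer.PrintCf2

/-! ## §1 The TYZ genus class at `ρ = 0`, class `6`, per `n` (tuple-free) -/

/-- **THE TYZ GENUS CLASS AT `ρ = 0`, CLASS `6`, tuple-free.** For square-free `n ≡ 6 (mod 8)` with `#Sel₂(E_n) = 8`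
(`s(n) = 1`), `ρ(n) = 0` (`[E_n(ℚ) : φ_n(A_n(ℚ)) + E_n[2]] = 1`) and the second genus sum `Σ₂′(n)` ODD (over
`K_d = GenusField d`): `ord_{s=1} L(E_n, s) = 1`, rank `E_n(ℚ) = 1`, `Ш(E_n)[2^∞] = 0` and **`BSD(E_n, 2)`** — modulo
exactly Tian–Yuan–Zhang 2017 Thm 1.2 AS PRINTED (`h12`, its `n ≡ 6` clause) and Gross–Zagier–Kolyvagin (`hGZK`); the
bridge (`#tor = 4`, `ord₂ ∏c_ℓ = 2k + 2 − a`, `Ω = Ω_{n,∞}`) is PROVED in the tree. The `n ≡ 6` companion of p1's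
`Rank1Residual.WAll.PrintCf2.rankOne_sha_bsdp_two_congruentNumberCurve_of_tyzGenus` (p535702), same proof with
`rankOneDatum_of_index_eq_one_six'`. Beyond print: YES (assembly); inputs PUB.
[cite: TianYuanZhang2017, Thm. 1.2 and §1 (1.1) (arXiv:1411.4728 p0002)] [cite: Tian2023CongruentICM, Thm. 8 (p. 1996), Thm. 13 (p. 2000–2001)]
[cite: SilvermanAEC2009, Thm. X.4.2] [cite: Miller2011LMS, Def. 1.1 (arXiv:1010.2431 p. 3)] -/
theorem rankOne_sha_bsdp_two_congruentNumberCurve_of_tyzGenus_six (h12 : thm12_parity_of_scriptL')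
    (hGZK : rank_eq_analyticRank_of_analyticRank_le_one) {n : ℕ} (hsq : Squarefree n) (h8 : n % 8 = 6)
    (hsel : haveI := isElliptic_congruentNumberCurve hsq.ne_zero;
      Nat.card ((congruentNumberCurve n).selmerGroup 2) = 8)
    (hρ : (rhoSubgroup n).index = 1)
    (hgen : Odd (genusSum₂' n fun d => genusClassNumber (GenusField d))) :
    haveI := isElliptic_congruentNumberCurve hsq.ne_zero
    (congruentNumberCurve n).analyticRank = 1 ∧ (congruentNumberCurve n).mordellWeilRank = 1 ∧
      AddCommGroup.primaryComponent (congruentNumberCurve n).sha 2 = ⊥ ∧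
      BSDp (congruentNumberCurve n) 2 := by
  haveI := isElliptic_congruentNumberCurve hsq.ne_zero
  haveI : Fact (Nat.Prime 2) := ⟨Nat.prime_two⟩
  obtain ⟨Lz, hLodd, hr1, hderiv⟩ :=
    rankOneDatum_of_index_eq_one_six' h12 hsq h8 hρ GenusField (isGenusFieldFamily_genusField n) hgen
  have hx : deriv (congruentNumberCurve n).entireLFunction 1 =
      (((2 : ℚ) ^ twoExponent n * (Lz : ℚ) ^ 2 : ℚ) : ℂ) *
        ((congruentNumberCurve n).realPeriodRat : ℂ) * ((congruentNumberCurve n).regulator : ℂ) := by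
    rw [hderiv]; push_cast; ring
  obtain ⟨hrank, -⟩ := hGZK (congruentNumberCurve n) (le_of_eq hr1)
  rw [hr1] at hrank
  have hbot := P2.primaryComponent_sha_two_eq_bot_of_card_selmerGroup_eq_eight hsq.ne_zero hrank hsel
  refine ⟨hr1, hrank, hbot, ?_⟩
  rw [P2.bsdp_two_iff_of_LDerivOverOmegaReg_of_sha_two_eq_bot_of_torsionOrder_eq_four
    (congruentNumberCurve n) hGZK hr1 hx hbot (torsionOrder_congruentNumberCurve hsq),
    P2.padicValRat_two_zpow_mul_sq hLodd,
    Rank1Residual.WAll.PrintCf2.twoExponent_eq_padicValNat_tamagawaProduct_sub_four hsq]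

/-! ## §2 CLOSER BY NAME of the leaf `WAllCornerFTwoRamifiedTYZRhoSix` -/

/-- **CLOSER of the ρ-six leaf, modulo TWO conjuncts of `𝔅_ram`**: TYZ Thm 1.2 as printed (`h12`, conjunct 5) and GZK
(`hGZK`, conjunct 1); model transport fact-free (`CornerFTwo.CongruentNumber.analyticRank_eq_one_and_bsdp_two_of_smul`).
The leaf's hypotheses `HasCM`, `r_an = 1`, `CMRamified` are not used (they HOLD on the class).
[cite: TianYuanZhang2017, Thm. 1.2] [cite: Tian2023CongruentICM, Thm. 8 and Thm. 13] [cite: Miller2011LMS, Def. 1.1] -/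
theorem wAllCornerFTwoRamifiedTYZRhoSix_of_facts (h12 : thm12_parity_of_scriptL')
    (hGZK : rank_eq_analyticRank_of_analyticRank_le_one) : WAllCornerFTwoRamifiedTYZRhoSix := by
  intro W _ _ _ _ _ hmem
  obtain ⟨n, hsq, h8, hsel, hρ, hgen, C, hC⟩ := hmem
  have h := rankOne_sha_bsdp_two_congruentNumberCurve_of_tyzGenus_six h12 hGZK hsq h8 hsel hρ hgen
  exact (P2.CornerFTwo.CongruentNumber.analyticRank_eq_one_and_bsdp_two_of_smul hsq ⟨h.1, h.2.2.2⟩ hC).2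

/-! ## §3 The stub, the reduction of the registered residual stub, and the crux's conclusion from the reshaped set -/

/-- **`stub_offTYZ_rhoSixLeaf`: 𝔅_ram ⟹ the ρ-six leaf, PROVED inside 𝔅_ram** (facts used: conjunct 5 = TYZ Thm 1.2′
and conjunct 1 = GZK; stub grammar `𝔅_ram → <W-ALL leaf>`; NOT a registered stub of 20509 — the class is empirically
thin, see the module docstring — landed as a helper). [cite: TianYuanZhang2017, Thm. 1.2] [cite: Miller2011LMS, Def. 1.1] -/
theorem stub_offTYZ_rhoSixLeaf : (Literature.NumberTheory.EllipticCurves.rank_eq_analyticRank_of_analyticRank_le_one ∧ WeierstrassCurve.hasEntireLFunction_rat ∧ WeierstrassCurve.bsdRHS_eq_of_isIsogenous ∧ Literature.NumberTheory.EllipticCurves.bsdTriple_of_hasCM_of_L_one_ne_zero ∧ Literature.NumberTheory.EllipticCurves.TianYuanZhang2017.thm12_parity_of_scriptL' ∧ Literature.NumberTheory.EllipticCurves.Tian2014.thm13_rank_one_and_sha_odd ∧ Literature.NumberTheory.QuadraticFields.RedeiReichardt.redeiReichardt_fourTwoCard_classGroup ∧ Literature.NumberTheory.EllipticCurves.LiLiuTian2024.thm12_bsd_congruentNumberCurve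 ∧ Literature.NumberTheory.EllipticCurves.Monsky1990.cor515_rank_eq_one_and_card_selmerGroup_two ∧ Literature.NumberTheory.EllipticCurves.HeathBrown1994.monsky_card_selmerGroup_two_even ∧ Literature.NumberTheory.EllipticCurves.Tian2014.tian2014_system_sMinus_genus) → Summit.BirchSwinnertonDyer.WAllCornerFTwoRamifiedTYZRhoSix :=
  fun hB ↦ wAllCornerFTwoRamifiedTYZRhoSix_of_facts hB.2.2.2.2.1 hB.1

/-- **The residual stub registered at 58c6ad09 (`𝔅_ram ⟹` five-way residual) follows from the six-way residual**
(`𝔅_ram ⟹ WAllCornerFTwoRamifiedOffTYZOffSMinusOffRhoSix`), the ρ-six part being proved (a formally exact but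
empirically thin cut, see the module docstring). [folklore] -/
theorem stub_offTYZ_residual_of_offSMinusOffRhoSix
    (hO : (Literature.NumberTheory.EllipticCurves.rank_eq_analyticRank_of_analyticRank_le_one ∧ WeierstrassCurve.hasEntireLFunction_rat ∧ WeierstrassCurve.bsdRHS_eq_of_isIsogenous ∧ Literature.NumberTheory.EllipticCurves.bsdTriple_of_hasCM_of_L_one_ne_zero ∧ Literature.NumberTheory.EllipticCurves.TianYuanZhang2017.thm12_parity_of_scriptL' ∧ Literature.NumberTheory.EllipticCurves.Tian2014.thm13_rank_one_and_sha_odd ∧ Literature.NumberTheory.QuadraticFields.RedeiReichardt.redeiReichardt_fourTwoCard_classGroup ∧ Literature.NumberTheory.EllipticCurves.LiLiuTian2024.thm12_bsd_congruentNumberCurve ∧ Literature.NumberTheory.EllipticCurves.Monsky1990.cor515_rank_eq_one_and_card_selmerGroup_two ∧ Literature.NumberTheory.EllipticCurves.HeathBrown1994.monsky_card_selmerGroup_two_even ∧ Literature.NumberTheory.EllipticCurves.Tian2014.tian2014_system_sMinus_genus) → Summit.BirchSwinnertonDyer.WAllCornerFTwoRamifiedOffTYZOffSMinusOffRhoSix)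 :
    (Literature.NumberTheory.EllipticCurves.rank_eq_analyticRank_of_analyticRank_le_one ∧ WeierstrassCurve.hasEntireLFunction_rat ∧ WeierstrassCurve.bsdRHS_eq_of_isIsogenous ∧ Literature.NumberTheory.EllipticCurves.bsdTriple_of_hasCM_of_L_one_ne_zero ∧ Literature.NumberTheory.EllipticCurves.TianYuanZhang2017.thm12_parity_of_scriptL' ∧ Literature.NumberTheory.EllipticCurves.Tian2014.thm13_rank_one_and_sha_odd ∧ Literature.NumberTheory.QuadraticFields.RedeiReichardt.redeiReichardt_fourTwoCard_classGroup ∧ Literature.NumberTheory.EllipticCurves.LiLiuTian2024.thm12_bsd_congruentNumberCurve ∧ Literature.NumberTheory.EllipticCurves.Monsky1990.cor515_rank_eq_one_and_card_selmerGroup_two ∧ Literature.NumberTheory.EllipticCurves.HeathBrown1994.monsky_card_selmerGroup_two_even ∧ Literature.NumberTheory.EllipticCurves.Tian2014.tian2014_system_sMinus_genus) → Summit.BirchSwinnertonDyer.WAllCornerFTwoRamifiedOffTYZOffSMinus :=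
  fun hB ↦ wAllCornerFTwoRamifiedOffTYZOffSMinus_of_rhoSix_of_off (stub_offTYZ_rhoSixLeaf hB) (hO hB)

/-- **The crux's conclusion from the reshaped stub set (five leaves)** — U⁺ leaf (hypothesis), FJ atlas (landed
p541735), `𝒮⁻` (landed p546023), ρ-six (this file), six-way residual (hypothesis). [folklore] -/
theorem offTYZProved_of_bundle_of_uPlus_of_off6 (hB : (Literature.NumberTheory.EllipticCurves.rank_eq_analyticRank_of_analyticRank_le_one ∧ WeierstrassCurve.hasEntireLFunction_rat ∧ WeierstrassCurve.bsdRHS_eq_of_isIsogenous ∧ Literature.NumberTheory.EllipticCurves.bsdTriple_of_hasCM_of_L_one_ne_zero ∧ Literature.NumberTheory.EllipticCurves.TianYuanZhang2017.thm12_parity_of_scriptL' ∧ Literature.NumberTheory.EllipticCurves.Tian2014.thm13_rank_one_and_sha_odd ∧ Literature.NumberTheory.QuadraticFields.RedeiReichardt.redeiReichardt_fourTwoCard_classGroup ∧ Literature.NumberTheory.EllipticCurves.LiLiuTian2024.thm12_bsd_congruentNumberCurve ∧ Literature.NumberTheory.EllipticCurves.Monsky1990.cor515_rank_eq_one_and_card_selmerGroup_two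 ∧ Literature.NumberTheory.EllipticCurves.HeathBrown1994.monsky_card_selmerGroup_two_even ∧ Literature.NumberTheory.EllipticCurves.Tian2014.tian2014_system_sMinus_genus))
    (hU : WAllCornerFTwoRamifiedTYZUPlus) (hO : WAllCornerFTwoRamifiedOffTYZOffSMinusOffRhoSix) :
    WAllCornerFTwoRamifiedOffTYZProved :=
  wAllCornerFTwoRamifiedOffTYZProved_of_uPlus_of_atlasFJ_of_sMinus_of_rhoSix_of_off hU
    (stub_offTYZ_atlasFJLeaf hB)
    (stub_offTYZ_sMinusLeaf hB) (stub_offTYZ_rhoSixLeaf hB) hO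

end Summit.BirchSwinnertonDyer.PrintCf2

end
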